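import Mathlib
import HarnessLib
import Summits.ResolutionOfSingularities.ResolutionOfSingularities.Theorems.WildQuotientsWildQuotientResolutionAffineQuotientBlowupModel
import Summits.ResolutionOfSingularities.ResolutionOfSingularities.Theorems.WildQuotientsWildQuotientResolutionZ9PeeledStableCover
import Summits.ResolutionOfSingularities.ResolutionOfSingularities.Theorems.WildQuotientsWildQuotientResolutionZ9PeeledI28Stable
import Summits.ResolutionOfSingularities.ResolutionOfSingularities.Theorems.WildQuotientsGaloisQuotientStableCover

/-!
# ℤ9 SPECIMEN (peeled `𝔸⁴/ℤ9`, char 3), brick Z5 — the QUOTIENT MODEL: `HasResolution (V/σ̄) → HasResolution (𝔸ⁿ/σ̄)`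

(crux stmt-ResolutionOfSingularities-15640 `WildQuotients.WildQuotientResolution`, line `Sketch`; S1 =
stmt-ResolutionOfSingularities-17941 `CyclicQuotientFourfolds`, non-linear sector; chain w45c card P specimen
«peeled 𝔸⁴/ℤ9» — res-L1-w45c-idea-2 memo `L/res-L1-w45c-idea-2/cardP_g12/Z9-SPECIMEN.md` §4 brick Z5 «quotient
model: X₁′ = V/σ̄ glued, X₁′ → X₁ proper + birational», res-L1-w45c-plan-1 ORDER 2026-08-27T16:36:47Z («Z5 =
stub-3») and NO OBJECTION 17:44:45Z (a) («Z5 part 2 = the ℤ9 instance of G2b»). [OURS · L1 W4.5c] — NOT a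
statement of any manuscript; replaces the role of no printed item; AI-produced, weaker than expert review.
Def-free. Letters of res-D-pv-033's Z2/Z3 files (abstract `g` with the exponent table, `σ` with `h0 hb`,
`ρ hρ`, ABSTRACT `hJ`, the lifted action `L γ := (affineBlowup.isBlowup I₂₈).liftAction ρ hJ γ`, vertex charts
`D₊ j := Proj.basicOpen (reesGrading I₂₈) (g j · t)`) and the scaffold binder `hρB : ρB.aut = liftAction ρ hJ`.
Prover res-L1-w45c-stub-3.)

* `stableAffineOpens_cover` — the three PIECES OF RECORD `P₀ = D₊ 0`, `P_T = ⨅_γ (L γ)⁻¹ D₊ 16`,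
  `P₂ = ⨅_γ (L γ)⁻¹ D₊ 23` (033's `…Z9PeeledStableCover`: stable, affine, covering) give every point of
  `V = Bl_{I₂₈} 𝔸ⁿ` a `⟨σ̄⟩`-stable affine open over `𝔸ⁿ/σ̄` containing it — the `hcov` of G2/G2b;
* **`hasResolution_of_glued`** — hence (G2b `AffineQuotient.hasResolution_mvPolynomial_fixedPoints_zpowers_of_liftAction_glued`
  with `I₂₈ ≠ 0` from `I28_ne_bot`): a resolution of the glued quotient `V/σ̄ = ρB.glued` gives
  `Scheme.HasResolution (Spec k[x]^⟨σ̄⟩)`. The remaining input `HasResolution ρB.glued` is Z6 (variant V-BR: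
  Bergh–Rydh on the pieces; res-L1-w45c-stub-1).
-/

-- single-problem summit: the doubled namespace component `ResolutionOfSingularities` is forced
set_option linter.dupNamespace false

noncomputable section

open CategoryTheory AlgebraicGeometry TopologicalSpace MvPolynomial
open scoped Pointwise
open Literature.AlgebraicGeometry.Resolution Literature.AlgebraicGeometry.RelativeSpec

namespace Summit.ResolutionOfSingularities.ResolutionOfSingularities.Theorems.WildQuotientResolution.Z9Peeled

variable (k : Type) [Field k] (n : ℕ) (a b c : Fin n)
  (g : Fin 24 → MvPolynomial (Fin n) k)
  (σ : MvPolynomial (Fin n) k ≃ₐ[k] MvPolynomial (Fin n) k) [Finite ↥(Subgroup.zpowers σ)]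

/-- **The pieces of record cover `V` by `⟨σ̄⟩`-stable affine opens over `𝔸ⁿ/σ̄`** (the `hcov` of G2b), for
any action-over structure `ρB` whose underlying action is the lifted one. [OURS · L1 W4.5c] -/
theorem stableAffineOpens_cover (h0 : σ (X a) = X a) (hb : σ (X b) = X b + X a)
    (hg : ∀ q, g q = X a ^ ((![(4, 0, 0), (3, 2, 0), (3, 1, 3), (3, 0, 7), (2, 4, 0), (2, 3, 2), (2, 2, 6),
      (2, 1, 10), (2, 0, 14), (1, 6, 0), (1, 5, 1), (1, 4, 5), (1, 3, 9), (1, 2, 13), (1, 1, 17), (1, 0, 21),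
      (0, 7, 0), (0, 6, 4), (0, 5, 8), (0, 4, 12), (0, 3, 16), (0, 2, 20), (0, 1, 24), (0, 0, 28)] :
        Fin 24 → ℕ × ℕ × ℕ) q).1 *
      X b ^ ((![(4, 0, 0), (3, 2, 0), (3, 1, 3), (3, 0, 7), (2, 4, 0), (2, 3, 2), (2, 2, 6),
      (2, 1, 10), (2, 0, 14), (1, 6, 0), (1, 5, 1), (1, 4, 5), (1, 3, 9), (1, 2, 13), (1, 1, 17), (1, 0, 21),
      (0, 7, 0), (0, 6, 4), (0, 5, 8), (0, 4, 12), (0, 3, 16), (0, 2, 20), (0, 1, 24), (0, 0, 28)] :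
        Fin 24 → ℕ × ℕ × ℕ) q).2.1 *
      X c ^ ((![(4, 0, 0), (3, 2, 0), (3, 1, 3), (3, 0, 7), (2, 4, 0), (2, 3, 2), (2, 2, 6),
      (2, 1, 10), (2, 0, 14), (1, 6, 0), (1, 5, 1), (1, 4, 5), (1, 3, 9), (1, 2, 13), (1, 1, 17), (1, 0, 21),
      (0, 7, 0), (0, 6, 4), (0, 5, 8), (0, 4, 12), (0, 3, 16), (0, 2, 20), (0, 1, 24), (0, 0, 28)] :
        Fin 24 → ℕ × ℕ × ℕ) q).2.2)
    (ρ : ↥(Subgroup.zpowers σ) →* Aut (Spec (CommRingCat.of (MvPolynomial (Fin n) k))))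
    (hρ : ∀ γ : ↥(Subgroup.zpowers σ), (ρ γ).hom = Spec.map (CommRingCat.ofHom
      ((MulSemiringAction.toRingEquiv (↥(Subgroup.zpowers σ)) (MvPolynomial (Fin n) k) γ⁻¹ :
        MvPolynomial (Fin n) k ≃+* MvPolynomial (Fin n) k) :
          MvPolynomial (Fin n) k →+* MvPolynomial (Fin n) k)))
    (hJ : ∀ γ : ↥(Subgroup.zpowers σ),
      (affineBlowup.idealSheaf (Ideal.span (Set.range g))).comap (ρ γ).hom =
        affineBlowup.idealSheaf (Ideal.span (Set.range g)))
    (ρB : ActionOver (affineBlowup.π (Ideal.span (Set.range g)) ≫ Spec.map (CommRingCat.ofHom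
      (algebraMap (FixedPoints.subalgebra k (MvPolynomial (Fin n) k) ↥(Subgroup.zpowers σ))
        (MvPolynomial (Fin n) k)))) ↥(Subgroup.zpowers σ))
    (hρB : ρB.aut = (affineBlowup.isBlowup (Ideal.span (Set.range g))).liftAction ρ hJ)
    (v : ↥(affineBlowup (Ideal.span (Set.range g)))) :
    ∃ O : ρB.StableAffineOpens, v ∈ O.1 := by
  -- names
  let I : Ideal (MvPolynomial (Fin n) k) := Ideal.span (Set.range g)
  let L := (affineBlowup.isBlowup I).liftAction ρ hJ
  let D : Fin 24 → (affineBlowup I).Opens := fun j =>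
    Proj.basicOpen (reesGrading I) (reesT (I := I) (g j) (Ideal.mem_span_range_self (f := g) (x := j)))
  let P : Fin 24 → (affineBlowup I).Opens := fun j => ⨅ γ : ↥(Subgroup.zpowers σ), (L γ).hom ⁻¹ᵁ (D j)
  haveI : (Spec (CommRingCat.of (FixedPoints.subalgebra k (MvPolynomial (Fin n) k)
    ↥(Subgroup.zpowers σ)))).IsSeparated := inferInstance
  -- the three stable affine opens
  have hD0_aff : IsAffineOpen (D 0) :=
    Proj.isAffineOpen_basicOpen (reesGrading I) _ (reesT_mem _ _) one_pos
  haveI : IsAffine ((D 0 : (affineBlowup I).Opens) : Scheme.{0}) := hD0_aff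
  have hD0_st : ∀ γ : ↥(Subgroup.zpowers σ), (ρB.aut γ).hom ⁻¹ᵁ (D 0) = D 0 := by
    intro γ; rw [hρB]
    exact preimage_vertexChartA_eq' k n a b c g σ h0 hg ρ hρ hJ γ
  have hP_st : ∀ (j : Fin 24) (γ : ↥(Subgroup.zpowers σ)), (ρB.aut γ).hom ⁻¹ᵁ (P j) = P j := by
    intro j γ; rw [hρB]
    exact preimage_piece_eq k n g σ ρ hJ j γ
  have hP_aff : ∀ j : Fin 24, IsAffineOpen (P j) := fun j => isAffineOpen_piece k n g σ ρ hJ j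
  haveI : IsAffine ((P 16 : (affineBlowup I).Opens) : Scheme.{0}) := hP_aff 16
  haveI : IsAffine ((P 23 : (affineBlowup I).Opens) : Scheme.{0}) := hP_aff 23
  let O0 : ρB.StableAffineOpens := ⟨D 0, hD0_st, isAffineHom_of_isAffine_of_isSeparated _⟩
  let OT : ρB.StableAffineOpens := ⟨P 16, hP_st 16, isAffineHom_of_isAffine_of_isSeparated _⟩
  let O2 : ρB.StableAffineOpens := ⟨P 23, hP_st 23, isAffineHom_of_isAffine_of_isSeparated _⟩
  -- the cover
  have hcov : D 0 ⊔ P 16 ⊔ P 23 = ⊤ :=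
    vertexChartA_sup_pieceT_sup_pieceC_eq_top k n a b c g σ h0 hb hg ρ hρ hJ
  have hv : v ∈ D 0 ⊔ P 16 ⊔ P 23 := by rw [hcov]; exact Opens.mem_top v
  rcases Opens.mem_sup.mp hv with h | h
  · rcases Opens.mem_sup.mp h with h | h
    · exact ⟨O0, h⟩
    · exact ⟨OT, h⟩
  · exact ⟨O2, h⟩

/-- **Z5 — THE QUOTIENT MODEL of the ℤ9 specimen**: for the peeled action `σ̄` (only `σ̄ x_a = x_a`,
`σ̄ x_b = x_b + x_a` and finiteness of `⟨σ̄⟩` are used), the affine action `ρ` (affine-quotient law), a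
`⟨σ̄⟩`-stable blow-up centre `I₂₈ = (g)` (`hJ`, abstract; discharged by 033's `idealSheaf_I28_comap`) and the
lifted action `ρB` on `V = Bl_{I₂₈} 𝔸ⁿ` over `𝔸ⁿ/σ̄`: **a resolution of `V/σ̄ = ρB.glued` gives
`Scheme.HasResolution (Spec k[x]^⟨σ̄⟩)`** (`V → 𝔸ⁿ` proper birational, `V` integral, the pieces of record
cover — G2b). The input `HasResolution ρB.glued` is brick Z6. [OURS · L1 W4.5c] -/
theorem hasResolution_of_glued (h0 : σ (X a) = X a) (hb : σ (X b) = X b + X a)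
    (hg : ∀ q, g q = X a ^ ((![(4, 0, 0), (3, 2, 0), (3, 1, 3), (3, 0, 7), (2, 4, 0), (2, 3, 2), (2, 2, 6),
      (2, 1, 10), (2, 0, 14), (1, 6, 0), (1, 5, 1), (1, 4, 5), (1, 3, 9), (1, 2, 13), (1, 1, 17), (1, 0, 21),
      (0, 7, 0), (0, 6, 4), (0, 5, 8), (0, 4, 12), (0, 3, 16), (0, 2, 20), (0, 1, 24), (0, 0, 28)] :
        Fin 24 → ℕ × ℕ × ℕ) q).1 *
      X b ^ ((![(4, 0, 0), (3, 2, 0), (3, 1, 3), (3, 0, 7), (2, 4, 0), (2, 3, 2), (2, 2, 6),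
      (2, 1, 10), (2, 0, 14), (1, 6, 0), (1, 5, 1), (1, 4, 5), (1, 3, 9), (1, 2, 13), (1, 1, 17), (1, 0, 21),
      (0, 7, 0), (0, 6, 4), (0, 5, 8), (0, 4, 12), (0, 3, 16), (0, 2, 20), (0, 1, 24), (0, 0, 28)] :
        Fin 24 → ℕ × ℕ × ℕ) q).2.1 *
      X c ^ ((![(4, 0, 0), (3, 2, 0), (3, 1, 3), (3, 0, 7), (2, 4, 0), (2, 3, 2), (2, 2, 6),
      (2, 1, 10), (2, 0, 14), (1, 6, 0), (1, 5, 1), (1, 4, 5), (1, 3, 9), (1, 2, 13), (1, 1, 17), (1, 0, 21),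
      (0, 7, 0), (0, 6, 4), (0, 5, 8), (0, 4, 12), (0, 3, 16), (0, 2, 20), (0, 1, 24), (0, 0, 28)] :
        Fin 24 → ℕ × ℕ × ℕ) q).2.2)
    (ρ : ↥(Subgroup.zpowers σ) →* Aut (Spec (CommRingCat.of (MvPolynomial (Fin n) k))))
    (hρ : ∀ γ : ↥(Subgroup.zpowers σ), (ρ γ).hom = Spec.map (CommRingCat.ofHom
      ((MulSemiringAction.toRingEquiv (↥(Subgroup.zpowers σ)) (MvPolynomial (Fin n) k) γ⁻¹ :
        MvPolynomial (Fin n) k ≃+* MvPolynomial (Fin n) k) :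
          MvPolynomial (Fin n) k →+* MvPolynomial (Fin n) k)))
    (hJ : ∀ γ : ↥(Subgroup.zpowers σ),
      (affineBlowup.idealSheaf (Ideal.span (Set.range g))).comap (ρ γ).hom =
        affineBlowup.idealSheaf (Ideal.span (Set.range g)))
    (ρB : ActionOver (affineBlowup.π (Ideal.span (Set.range g)) ≫ Spec.map (CommRingCat.ofHom
      (algebraMap (FixedPoints.subalgebra k (MvPolynomial (Fin n) k) ↥(Subgroup.zpowers σ))
        (MvPolynomial (Fin n) k)))) ↥(Subgroup.zpowers σ))
    (hρB : ρB.aut = (affineBlowup.isBlowup (Ideal.span (Set.range g))).liftAction ρ hJ)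
    (hres : Scheme.HasResolution ρB.glued) :
    Scheme.HasResolution
      (Spec (CommRingCat.of (FixedPoints.subalgebra k (MvPolynomial (Fin n) k) ↥(Subgroup.zpowers σ)))) :=
  AffineQuotient.hasResolution_mvPolynomial_fixedPoints_zpowers_of_liftAction_glued k n σ (Fin.pos a) ρ hρ
    (Ideal.span (Set.range g)) (I28_ne_bot k n a b c g hg) hJ ρB hρB
    (stableAffineOpens_cover k n a b c g σ h0 hb hg ρ hρ hJ ρB hρB) hres


/-- **The three pieces of record as NAMED stable affine opens** (res-L1-w45c-stub-1's Z6 interface ask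
2026-08-27T18:27:04Z; `∃`-form to stay def-free): there are `P0 PT P2 : ρB.StableAffineOpens` with carriers
`D₊ 0`, `⨅_γ (L γ)⁻¹ D₊ 16`, `⨅_γ (L γ)⁻¹ D₊ 23` covering `V` — `obtain ⟨P0, PT, P2, h0', hT, h2, hmem⟩` and
feed `![P0, PT, P2]` to `PeelingFrame.hasResolution_glued_of_pieceGradedCharts_of_berghRydh`. [OURS · L1 W4.5c] -/
theorem exists_pieces (h0 : σ (X a) = X a) (hb : σ (X b) = X b + X a)
    (hg : ∀ q, g q = X a ^ ((![(4, 0, 0), (3, 2, 0), (3, 1, 3), (3, 0, 7), (2, 4, 0), (2, 3, 2), (2, 2, 6),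
      (2, 1, 10), (2, 0, 14), (1, 6, 0), (1, 5, 1), (1, 4, 5), (1, 3, 9), (1, 2, 13), (1, 1, 17), (1, 0, 21),
      (0, 7, 0), (0, 6, 4), (0, 5, 8), (0, 4, 12), (0, 3, 16), (0, 2, 20), (0, 1, 24), (0, 0, 28)] :
        Fin 24 → ℕ × ℕ × ℕ) q).1 *
      X b ^ ((![(4, 0, 0), (3, 2, 0), (3, 1, 3), (3, 0, 7), (2, 4, 0), (2, 3, 2), (2, 2, 6),
      (2, 1, 10), (2, 0, 14), (1, 6, 0), (1, 5, 1), (1, 4, 5), (1, 3, 9), (1, 2, 13), (1, 1, 17), (1, 0, 21),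
      (0, 7, 0), (0, 6, 4), (0, 5, 8), (0, 4, 12), (0, 3, 16), (0, 2, 20), (0, 1, 24), (0, 0, 28)] :
        Fin 24 → ℕ × ℕ × ℕ) q).2.1 *
      X c ^ ((![(4, 0, 0), (3, 2, 0), (3, 1, 3), (3, 0, 7), (2, 4, 0), (2, 3, 2), (2, 2, 6),
      (2, 1, 10), (2, 0, 14), (1, 6, 0), (1, 5, 1), (1, 4, 5), (1, 3, 9), (1, 2, 13), (1, 1, 17), (1, 0, 21),
      (0, 7, 0), (0, 6, 4), (0, 5, 8), (0, 4, 12), (0, 3, 16), (0, 2, 20), (0, 1, 24), (0, 0, 28)] :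
        Fin 24 → ℕ × ℕ × ℕ) q).2.2)
    (ρ : ↥(Subgroup.zpowers σ) →* Aut (Spec (CommRingCat.of (MvPolynomial (Fin n) k))))
    (hρ : ∀ γ : ↥(Subgroup.zpowers σ), (ρ γ).hom = Spec.map (CommRingCat.ofHom
      ((MulSemiringAction.toRingEquiv (↥(Subgroup.zpowers σ)) (MvPolynomial (Fin n) k) γ⁻¹ :
        MvPolynomial (Fin n) k ≃+* MvPolynomial (Fin n) k) :
          MvPolynomial (Fin n) k →+* MvPolynomial (Fin n) k)))
    (hJ : ∀ γ : ↥(Subgroup.zpowers σ),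
      (affineBlowup.idealSheaf (Ideal.span (Set.range g))).comap (ρ γ).hom =
        affineBlowup.idealSheaf (Ideal.span (Set.range g)))
    (ρB : ActionOver (affineBlowup.π (Ideal.span (Set.range g)) ≫ Spec.map (CommRingCat.ofHom
      (algebraMap (FixedPoints.subalgebra k (MvPolynomial (Fin n) k) ↥(Subgroup.zpowers σ))
        (MvPolynomial (Fin n) k)))) ↥(Subgroup.zpowers σ))
    (hρB : ρB.aut = (affineBlowup.isBlowup (Ideal.span (Set.range g))).liftAction ρ hJ) :
    ∃ P0 PT P2 : ρB.StableAffineOpens,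
      P0.1 = Proj.basicOpen (reesGrading (Ideal.span (Set.range g)))
          (reesT (I := Ideal.span (Set.range g)) (g 0) (Ideal.mem_span_range_self (f := g) (x := 0))) ∧
      PT.1 = (⨅ γ : ↥(Subgroup.zpowers σ),
          (((affineBlowup.isBlowup (Ideal.span (Set.range g))).liftAction ρ hJ) γ).hom ⁻¹ᵁ
            (Proj.basicOpen (reesGrading (Ideal.span (Set.range g)))
              (reesT (I := Ideal.span (Set.range g)) (g 16) (Ideal.mem_span_range_self (f := g) (x := 16))))) ∧
      P2.1 = (⨅ γ : ↥(Subgroup.zpowers σ),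
          (((affineBlowup.isBlowup (Ideal.span (Set.range g))).liftAction ρ hJ) γ).hom ⁻¹ᵁ
            (Proj.basicOpen (reesGrading (Ideal.span (Set.range g)))
              (reesT (I := Ideal.span (Set.range g)) (g 23) (Ideal.mem_span_range_self (f := g) (x := 23))))) ∧
      ∀ x : ↥(affineBlowup (Ideal.span (Set.range g))), x ∈ P0.1 ∨ x ∈ PT.1 ∨ x ∈ P2.1 := by
  -- names (as in `stableAffineOpens_cover`)
  let I : Ideal (MvPolynomial (Fin n) k) := Ideal.span (Set.range g)
  let L := (affineBlowup.isBlowup I).liftAction ρ hJ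
  let D : Fin 24 → (affineBlowup I).Opens := fun j =>
    Proj.basicOpen (reesGrading I) (reesT (I := I) (g j) (Ideal.mem_span_range_self (f := g) (x := j)))
  let P : Fin 24 → (affineBlowup I).Opens := fun j => ⨅ γ : ↥(Subgroup.zpowers σ), (L γ).hom ⁻¹ᵁ (D j)
  haveI : (Spec (CommRingCat.of (FixedPoints.subalgebra k (MvPolynomial (Fin n) k)
    ↥(Subgroup.zpowers σ)))).IsSeparated := inferInstance
  have hD0_aff : IsAffineOpen (D 0) :=
    Proj.isAffineOpen_basicOpen (reesGrading I) _ (reesT_mem _ _) one_pos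
  haveI : IsAffine ((D 0 : (affineBlowup I).Opens) : Scheme.{0}) := hD0_aff
  have hD0_st : ∀ γ : ↥(Subgroup.zpowers σ), (ρB.aut γ).hom ⁻¹ᵁ (D 0) = D 0 := by
    intro γ; rw [hρB]
    exact preimage_vertexChartA_eq' k n a b c g σ h0 hg ρ hρ hJ γ
  have hP_st : ∀ (j : Fin 24) (γ : ↥(Subgroup.zpowers σ)), (ρB.aut γ).hom ⁻¹ᵁ (P j) = P j := by
    intro j γ; rw [hρB]
    exact preimage_piece_eq k n g σ ρ hJ j γ
  have hP_aff : ∀ j : Fin 24, IsAffineOpen (P j) := fun j => isAffineOpen_piece k n g σ ρ hJ j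
  haveI : IsAffine ((P 16 : (affineBlowup I).Opens) : Scheme.{0}) := hP_aff 16
  haveI : IsAffine ((P 23 : (affineBlowup I).Opens) : Scheme.{0}) := hP_aff 23
  have hcov : D 0 ⊔ P 16 ⊔ P 23 = ⊤ :=
    vertexChartA_sup_pieceT_sup_pieceC_eq_top k n a b c g σ h0 hb hg ρ hρ hJ
  refine ⟨⟨D 0, hD0_st, isAffineHom_of_isAffine_of_isSeparated _⟩,
    ⟨P 16, hP_st 16, isAffineHom_of_isAffine_of_isSeparated _⟩,
    ⟨P 23, hP_st 23, isAffineHom_of_isAffine_of_isSeparated _⟩, rfl, rfl, rfl, fun x => ?_⟩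
  have hx : x ∈ D 0 ⊔ P 16 ⊔ P 23 := by rw [hcov]; exact Opens.mem_top x
  rcases Opens.mem_sup.mp hx with h | h
  · rcases Opens.mem_sup.mp h with h | h
    · exact Or.inl h
    · exact Or.inr (Or.inl h)
  · exact Or.inr (Or.inr h)

end Summit.ResolutionOfSingularities.ResolutionOfSingularities.Theorems.WildQuotientResolution.Z9Peeled

end
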